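import Mathlib
import Summits.MatrixMultiplication.MatrixMultiplication.Theses.LevelGradedCohnUmans

/-!
# Parabola lifts for the stub `stub_tangencySets` of the crux `LevelOneGL2Designs`
(stmt-MatrixMultiplication-14080, wall-breaker axis k2/12: "parabola lifts over finite fields")

The stub asks for strong representative systems (tangency sets) of `AG(2,p)` of size `c·p^{3/2}`
for unboundedly many primes `p`, in the format

  `S ⊆ (𝔽_p² × 𝔽_p²)`, `⟨f.1, f'.2⟩ = 1 ↔ f = f'` (a point `f.1` and a line `{x | ⟨x, f.2⟩ = 1}`).

**Parabola lift.**  Foliate the affine plane by the translates `y = x² + k` of the standard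
parabola and attach to a parameter `t = (a,k) ∈ 𝔽_p²` the flag
`(point (a, a²+k), tangent line y = 2a·x + (k - a²))`.  A parameter set `T ⊆ 𝔽_p²` lifts to a
strong representative system iff `T` is *parabola-free*:

  `∀ t t' ∈ T, (t'.1 - t.1)² = t.2 - t'.2 → t'.1 = t.1`,

i.e. the difference set `T - T` avoids the punctured parabola `{(d, d²) : d ≠ 0}`
(`tangency_of_parabolaFree`), after discarding the `≤ p` parameters whose tangent passes through
the origin (`card_le_card_filter_offParabola_add`).  Hence the stub follows from the purely
additive statement "parabola-free sets of size `c·p^{3/2}` exist for unboundedly many primes"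
(`tangencySets_of_parabolaFree`), which is sharp up to the constant (Hoffman/character-sum bound)
and is attained for square `q` by `𝔽_q × i·𝔽_√q` (a Buekenhout–Metz unital).

**Integer lift** (Hunter–Pohoata–Verstraëte–Zhang 2026, Prop. 2.3 / Thm. 1.2, the current
record for prime fields).  If `K ⊆ [M², M²+N)` has no two elements differing by a non-zero
perfect square and `M² + N ≤ p`, then `[0,M) × K` (read in `𝔽_p²`) is parabola-free with all
tangents avoiding the origin, giving a strong representative system of size exactly `M·|K|`
(`tangencySet_intLift`).  With Ruzsa's `65`-adic square-difference-free sets (Ruzsa 1984;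
`|K ∩ [0,65^{2t})| = 455^t`, `Literature.Combinatorics.Additive.exists_sqDiffFree_ruzsa`) this
yields strong representative systems of size `M·455^t` whenever `M² + 4225^t ≤ p`, hence of
size `≥ p^{123/100}/14560` for EVERY prime `p` (the true exponent of the construction is
`1/2 + log 455 / log 4225 = 1.2331…`, and `1.2334` with Lewko's base `205`): theorems
`tangencySet_ruzsa` and `tangencySet_exponent` of the companion file
`LevelGradedCohnUmansLevelOneGL2DesignsParabolaLiftRuzsa.lean`.

What is NOT here: parabola-free sets of size `c·p^{3/2}` over prime fields.  This is open and
conjectured impossible in a stronger form (HPVZ 2026, Conjecture 10.2: `IM(2,p) ≤ p^{3/2-c}` for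
all large primes, which would also break the square-root barrier for Paley cliques and give a
power saving in Furstenberg–Sárközy); the product ansatz `[0,M) × K` is capped at `o(p^{3/2})`
by the Furstenberg–Sárközy theorem itself, and the pencil ansatz `𝔽_p × K` at `p·ω(Paley_p)`.
See AXIS.md of the wall-breaker unit.

References: Z. Hunter, C. Pohoata, J. Verstraëte, S. Zhang, *Large point-line matchings and
small Nikodym sets*, arXiv:2601.19879 (2026) [bib: HunterPohoataVerstraeteZhang2026];
I. Z. Ruzsa, *Difference sets without squares*, Period. Math. Hungar. 15 (1984) 205–209
[bib: Ruzsa1984DifferenceSetsWithoutSquares]; T. Szőnyi, Combinatorica 12 (1992)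
[bib: Szonyi1992LargeMinimalBlockingSets] (the pencil/Paley version).
-/

-- justification: the summit/problem path `MatrixMultiplication.MatrixMultiplication` is fixed by the
-- tree layout (D-0017), so the namespace necessarily repeats a component.
set_option linter.dupNamespace false

noncomputable section

open Matrix

namespace Summit.MatrixMultiplication.MatrixMultiplication.Theorems.LevelOneGL2Designs.ParabolaLift

section Lift

variable {p : ℕ} [Fact p.Prime]

/-- **Parabola lift.**  A parabola-free parameter set `T ⊆ 𝔽_p × 𝔽_p` all of whose tangents
`y = 2a·x + (k - a²)` avoid the origin (`k ≠ a²`) lifts to a strong representative system of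
`AG(2,p)` of the same size, in the format of `stub_tangencySets`: the flag of `(a,k)` is the point
`(a, a² + k)` together with the line `-2a·x + y = k - a²`, normalised to `⟨x, b⟩ = 1`. [elementary] -/
theorem tangency_of_parabolaFree (T : Finset (ZMod p × ZMod p))
    (hT : ∀ t ∈ T, ∀ t' ∈ T, (t'.1 - t.1) ^ 2 = t.2 - t'.2 → t'.1 = t.1)
    (h0 : ∀ t ∈ T, t.2 ≠ t.1 ^ 2) :
    ∃ S : Finset ((Fin 2 → ZMod p) × (Fin 2 → ZMod p)), S.card = T.card ∧
      ∀ f ∈ S, ∀ f' ∈ S, (dotProduct f.1 f'.2 = 1 ↔ f = f') := by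
  classical
  set Φ : ZMod p × ZMod p → (Fin 2 → ZMod p) × (Fin 2 → ZMod p) := fun t =>
    (![t.1, t.1 ^ 2 + t.2], ![-(2 * t.1) / (t.2 - t.1 ^ 2), 1 / (t.2 - t.1 ^ 2)]) with hΦ
  have hinj : Function.Injective Φ := by
    intro t t' h
    simp only [hΦ, Prod.mk.injEq] at h
    obtain ⟨h1, -⟩ := h
    have ha : t.1 = t'.1 := by
      have := congrFun h1 0
      simpa using this
    have hk : t.1 ^ 2 + t.2 = t'.1 ^ 2 + t'.2 := by
      have := congrFun h1 1
      simpa using this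
    rw [ha] at hk
    exact Prod.ext ha (add_left_cancel hk)
  refine ⟨T.image Φ, Finset.card_image_of_injective _ hinj, ?_⟩
  intro f hf f' hf'
  simp only [Finset.mem_image] at hf hf'
  obtain ⟨t', ht', rfl⟩ := hf
  obtain ⟨t, ht, rfl⟩ := hf'
  have hc : t.2 - t.1 ^ 2 ≠ 0 := sub_ne_zero.mpr (h0 t ht)
  have hdot : dotProduct (Φ t').1 (Φ t).2 =
      (-(2 * t.1) * t'.1 + (t'.1 ^ 2 + t'.2)) / (t.2 - t.1 ^ 2) := by
    simp only [hΦ, dotProduct, Fin.sum_univ_two, Matrix.cons_val_zero, Matrix.cons_val_one]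
    field_simp
  constructor
  · intro h
    rw [hdot, div_eq_one_iff_eq hc] at h
    have key : (t'.1 - t.1) ^ 2 = t.2 - t'.2 := by linear_combination h
    have h1 : t'.1 = t.1 := hT t ht t' ht' key
    have h2 : t'.2 = t.2 := by
      rw [h1, sub_self, zero_pow two_ne_zero] at key
      linear_combination key
    rw [Prod.ext h1 h2]
  · intro h
    have htt : t' = t := hinj h
    subst htt
    rw [hdot, div_eq_one_iff_eq hc]
    ring

/-- Discarding the parameters whose tangent passes through the origin (`k = a²`) costs at most
`p` elements: such parameters are determined by their first coordinate. [elementary] -/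
theorem card_le_card_filter_offParabola_add (T : Finset (ZMod p × ZMod p)) :
    T.card ≤ (T.filter fun t => t.2 ≠ t.1 ^ 2).card + p := by
  classical
  have hbad : (T.filter fun t => ¬ t.2 ≠ t.1 ^ 2).card ≤ p := by
    calc (T.filter fun t => ¬ t.2 ≠ t.1 ^ 2).card
        ≤ (Finset.univ : Finset (ZMod p)).card := by
          refine Finset.card_le_card_of_injOn Prod.fst (fun _ _ => Finset.mem_univ _) ?_
          intro t ht t' ht' h
          simp only [ne_eq, not_not, Finset.coe_filter, Set.mem_setOf_eq] at ht ht'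
          exact Prod.ext h (by rw [ht.2, ht'.2, h])
      _ = p := by rw [Finset.card_univ, ZMod.card]
  have := Finset.card_filter_add_card_filter_not (p := fun t => t.2 ≠ t.1 ^ 2) (s := T)
  omega

/-- **Reduction of `stub_tangencySets` to parabola-free sets.**  If for some `c > 0` and
unboundedly many primes `p` there is a parabola-free `T ⊆ 𝔽_p × 𝔽_p` with `|T| ≥ c·p^{3/2}`, then
the signature of `stub_tangencySets` holds (with constant `c/2`): lift `T` minus the `≤ p`
parameters whose tangent passes through the origin, for primes `p ≥ 4/c²`. [elementary] -/
theorem tangencySets_of_parabolaFree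
    (h : ∃ c : ℝ, 0 < c ∧ ∀ p₀ : ℕ, ∃ (p : ℕ) (_ : Fact p.Prime), p₀ ≤ p ∧
      ∃ T : Finset (ZMod p × ZMod p), c * (p : ℝ) ^ (3 / 2 : ℝ) ≤ T.card ∧
        ∀ t ∈ T, ∀ t' ∈ T, (t'.1 - t.1) ^ 2 = t.2 - t'.2 → t'.1 = t.1) :
    ∃ c : ℝ, 0 < c ∧ ∀ p₀ : ℕ, ∃ (p : ℕ) (_ : Fact p.Prime), p₀ ≤ p ∧
      ∃ S : Finset ((Fin 2 → ZMod p) × (Fin 2 → ZMod p)),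
        c * (p : ℝ) ^ (3 / 2 : ℝ) ≤ S.card ∧
        ∀ f ∈ S, ∀ f' ∈ S, (dotProduct f.1 f'.2 = 1 ↔ f = f') := by
  classical
  obtain ⟨c, hc, hfam⟩ := h
  refine ⟨c / 2, by positivity, fun p₀ => ?_⟩
  obtain ⟨p, hp, hp₀, T, hTcard, hT⟩ := hfam (max p₀ ⌈4 / c ^ 2⌉₊)
  refine ⟨p, hp, le_trans (le_max_left _ _) hp₀, ?_⟩
  -- the lifted set
  set T' := T.filter fun t => t.2 ≠ t.1 ^ 2 with hT'
  obtain ⟨S, hScard, hS⟩ := tangency_of_parabolaFree T'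
    (fun t ht t' ht' => hT t (Finset.mem_filter.mp ht).1 t' (Finset.mem_filter.mp ht').1)
    (fun t ht => (Finset.mem_filter.mp ht).2)
  refine ⟨S, ?_, hS⟩
  have hcardNat : T.card ≤ S.card + p := hScard ▸ card_le_card_filter_offParabola_add T
  have hcard : (T.card : ℝ) ≤ S.card + p := by exact_mod_cast hcardNat
  -- `p ≥ 4/c²`, hence `p ≤ (c/2)·p^{3/2}`
  have hp4 : (4 : ℝ) / c ^ 2 ≤ p := by
    have h1 : (⌈4 / c ^ 2⌉₊ : ℝ) ≤ p := by exact_mod_cast le_trans (le_max_right _ _) hp₀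
    exact le_trans (Nat.le_ceil _) h1
  have hppos : (0 : ℝ) < p := by exact_mod_cast hp.out.pos
  have hsqrt : 2 / c ≤ Real.sqrt p := by
    rw [Real.le_sqrt (by positivity) hppos.le]
    calc (2 / c) ^ 2 = (4 : ℝ) / c ^ 2 := by ring
      _ ≤ (p : ℝ) := hp4
  have h32 : (p : ℝ) ^ (3 / 2 : ℝ) = p * Real.sqrt p := by
    rw [Real.sqrt_eq_rpow, show (3 / 2 : ℝ) = 1 + 1 / 2 by norm_num, Real.rpow_add hppos,
      Real.rpow_one]
  have hple : (p : ℝ) ≤ c / 2 * (p : ℝ) ^ (3 / 2 : ℝ) := by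
    rw [h32]
    have : (1 : ℝ) ≤ c / 2 * Real.sqrt p := by
      have h2 : c / 2 * (2 / c) = 1 := by field_simp
      calc (1 : ℝ) = c / 2 * (2 / c) := h2.symm
        _ ≤ c / 2 * Real.sqrt p := by gcongr
    calc (p : ℝ) = p * 1 := (mul_one _).symm
      _ ≤ p * (c / 2 * Real.sqrt p) := by gcongr
      _ = c / 2 * (p * Real.sqrt p) := by ring
  linarith

end Lift

section IntLift

variable {p : ℕ} [Fact p.Prime]

/-- **Integer parabola lift** (Hunter–Pohoata–Verstraëte–Zhang 2026, Proposition 2.3, in the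
format of `stub_tangencySets` and without loss of a constant).  Let `K ⊆ [M², M² + N)` be a set
of naturals no two of which differ by a non-zero perfect square, and suppose `M² + N ≤ p`.  Then the parameters `[0,M) × K`, read in
`𝔽_p × 𝔽_p`, are parabola-free with all tangents avoiding the origin, so they lift to a strong
representative system of `AG(2,p)` of size exactly `M·|K|`: a relation `(a'-a)² = k - k'` in `𝔽_p`
with `|a'-a| < M` and `k, k' ∈ K` is an identity of integers (both sides have absolute value
`< p`), i.e. a square difference inside `K`. [elementary] -/
theorem tangencySet_intLift (M N : ℕ) (K : Finset ℕ)
    (hKlo : ∀ k ∈ K, M ^ 2 ≤ k) (hKhi : ∀ k ∈ K, k < M ^ 2 + N)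
    (hK : ∀ k ∈ K, ∀ k' ∈ K, ∀ j : ℕ, k = k' + j ^ 2 → j = 0) (hMN : M ^ 2 + N ≤ p) :
    ∃ S : Finset ((Fin 2 → ZMod p) × (Fin 2 → ZMod p)), S.card = M * K.card ∧
      ∀ f ∈ S, ∀ f' ∈ S, (dotProduct f.1 f'.2 = 1 ↔ f = f') := by
  classical
  set T : Finset (ZMod p × ZMod p) :=
    (Finset.range M ×ˢ K).image fun x => ((x.1 : ZMod p), (x.2 : ZMod p)) with hTdef
  have hMp : M ≤ p :=
    le_trans (Nat.le_self_pow two_ne_zero M) (le_trans (Nat.le_add_right _ _) hMN)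
  have hKp : ∀ k ∈ K, k < p := fun k hk => lt_of_lt_of_le (hKhi k hk) hMN
  have hinj : Set.InjOn (fun x : ℕ × ℕ => ((x.1 : ZMod p), (x.2 : ZMod p)))
      ↑(Finset.range M ×ˢ K) := by
    rintro ⟨a, k⟩ hak ⟨a', k'⟩ hak' h
    simp only [Finset.coe_product, Set.mem_prod, Finset.mem_coe, Finset.mem_range] at hak hak'
    simp only [Prod.mk.injEq] at h
    obtain ⟨ha, hk⟩ := h
    have ha' : a = a' := by
      have := (ZMod.natCast_eq_natCast_iff' a a' p).mp ha
      rwa [Nat.mod_eq_of_lt (lt_of_lt_of_le hak.1 hMp),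
        Nat.mod_eq_of_lt (lt_of_lt_of_le hak'.1 hMp)] at this
    have hk' : k = k' := by
      have := (ZMod.natCast_eq_natCast_iff' k k' p).mp hk
      rwa [Nat.mod_eq_of_lt (hKp k hak.2), Nat.mod_eq_of_lt (hKp k' hak'.2)] at this
    rw [ha', hk']
  have hTcard : T.card = M * K.card := by
    rw [hTdef, Finset.card_image_of_injOn hinj, Finset.card_product, Finset.card_range]
  have hfree : ∀ t ∈ T, ∀ t' ∈ T, (t'.1 - t.1) ^ 2 = t.2 - t'.2 → t'.1 = t.1 := by
    intro t ht t' ht' h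
    simp only [hTdef, Finset.mem_image, Finset.mem_product, Finset.mem_range, Prod.exists] at ht ht'
    obtain ⟨a, k, ⟨ha, hk⟩, rfl⟩ := ht
    obtain ⟨a', k', ⟨ha', hk'⟩, rfl⟩ := ht'
    simp only at h ⊢
    have hdvd : (p : ℤ) ∣ ((a' : ℤ) - a) ^ 2 - ((k : ℤ) - k') := by
      rw [← ZMod.intCast_zmod_eq_zero_iff_dvd]
      push_cast
      rw [h]
      ring
    have hMN' : ((M : ℤ)) ^ 2 + N ≤ p := by exact_mod_cast hMN
    have hk1 : ((M : ℤ)) ^ 2 ≤ k := by exact_mod_cast hKlo k hk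
    have hk2 : (k : ℤ) < (M : ℤ) ^ 2 + N := by exact_mod_cast hKhi k hk
    have hk1' : ((M : ℤ)) ^ 2 ≤ k' := by exact_mod_cast hKlo k' hk'
    have hk2' : (k' : ℤ) < (M : ℤ) ^ 2 + N := by exact_mod_cast hKhi k' hk'
    have hsq : ((a' : ℤ) - a) ^ 2 < (M : ℤ) ^ 2 := by
      apply sq_lt_sq' <;> omega
    have hsq0 : (0 : ℤ) ≤ ((a' : ℤ) - a) ^ 2 := sq_nonneg _
    have habs : |((a' : ℤ) - a) ^ 2 - ((k : ℤ) - k')| < p := by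
      rw [abs_lt]
      constructor <;> linarith
    have hzero := Int.eq_zero_of_abs_lt_dvd hdvd habs
    obtain ⟨j, hj⟩ : ∃ j : ℕ, (j : ℤ) ^ 2 = ((a' : ℤ) - a) ^ 2 :=
      ⟨((a' : ℤ) - a).natAbs, Int.natAbs_sq _⟩
    have hkk : k = k' + j ^ 2 := by
      have : (k : ℤ) = k' + (j : ℤ) ^ 2 := by linarith
      exact_mod_cast this
    have hj0 : j = 0 := hK k hk k' hk' j hkk
    subst hj0
    have haa : (a' : ℤ) = a := by
      have h0 : ((a' : ℤ) - a) ^ 2 = 0 := by rw [← hj]; simp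
      have := pow_eq_zero_iff (n := 2) two_ne_zero |>.mp h0
      linarith
    have : a' = a := by exact_mod_cast haa
    rw [this]
  have hoff : ∀ t ∈ T, t.2 ≠ t.1 ^ 2 := by
    intro t ht
    simp only [hTdef, Finset.mem_image, Finset.mem_product, Finset.mem_range, Prod.exists] at ht
    obtain ⟨a, k, ⟨ha, hk⟩, rfl⟩ := ht
    simp only
    intro h
    have ha2 : a ^ 2 < M ^ 2 := Nat.pow_lt_pow_left ha two_ne_zero
    have h' : ((k : ℕ) : ZMod p) = ((a ^ 2 : ℕ) : ZMod p) := by push_cast; exact h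
    rw [ZMod.natCast_eq_natCast_iff', Nat.mod_eq_of_lt (hKp k hk),
      Nat.mod_eq_of_lt (lt_of_lt_of_le ha2 (le_trans (Nat.le_add_right _ _) hMN))] at h'
    have := hKlo k hk
    omega
  obtain ⟨S, hS, hSprop⟩ := tangency_of_parabolaFree T hfree hoff
  exact ⟨S, hS.trans hTcard, hSprop⟩

end IntLift

end Summit.MatrixMultiplication.MatrixMultiplication.Theorems.LevelOneGL2Designs.ParabolaLift
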